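import Summits.CriticalPhenomena.PercolationContinuityZ3.Theorems.PercNearOneGluingNoHeavyLowerTailMajorityGluingZFourteenEightP61
import Summits.CriticalPhenomena.PercolationContinuityZ3.Theorems.PercNearOneGluingNoHeavyLowerTailMajorityGluingZFourteenEightP62
import Summits.CriticalPhenomena.PercolationContinuityZ3.Theorems.PercNearOneGluingNoHeavyLowerTailMajorityGluingZFourteenEightP63
import Summits.CriticalPhenomena.PercolationContinuityZ3.Theorems.PercNearOneGluingNoHeavyLowerTailMajorityGluingZFourteenEightP64
import Summits.CriticalPhenomena.PercolationContinuityZ3.Theorems.PercNearOneGluingNoHeavyLowerTailMajorityGluingZFourteenEightP65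
import Summits.CriticalPhenomena.PercolationContinuityZ3.Theorems.PercNearOneGluingNoHeavyLowerTailMajorityGluingZFourteenEightP66
import Summits.CriticalPhenomena.PercolationContinuityZ3.Theorems.PercNearOneGluingNoHeavyLowerTailMajorityGluingZFourteenEightP67
import Summits.CriticalPhenomena.PercolationContinuityZ3.Theorems.PercNearOneGluingNoHeavyLowerTailMajorityGluingZFourteenEightP68
import Summits.CriticalPhenomena.PercolationContinuityZ3.Theorems.PercNearOneGluingNoHeavyLowerTailMajorityGluingZFourteenEightP69
import Summits.CriticalPhenomena.PercolationContinuityZ3.Theorems.PercNearOneGluingNoHeavyLowerTailMajorityGluingZFourteenEightP70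
import Summits.CriticalPhenomena.PercolationContinuityZ3.Theorems.PercNearOneGluingNoHeavyLowerTailMajorityGluingZFourteenEightP71
import Summits.CriticalPhenomena.PercolationContinuityZ3.Theorems.PercNearOneGluingNoHeavyLowerTailMajorityGluingZFourteenEightP72
import Summits.CriticalPhenomena.PercolationContinuityZ3.Theorems.PercNearOneGluingNoHeavyLowerTailMajorityGluingZFourteenEightHG6C1
import Summits.CriticalPhenomena.PercolationContinuityZ3.Theorems.PercNearOneGluingNoHeavyLowerTailMajorityGluingZFourteenEightHG6C2
import Summits.CriticalPhenomena.PercolationContinuityZ3.Theorems.PercNearOneGluingNoHeavyLowerTailMajorityGluingZFourteenEightHG6C3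
import Summits.CriticalPhenomena.PercolationContinuityZ3.Theorems.PercNearOneGluingNoHeavyLowerTailMajorityGluingZFourteenEightHG6C4
import Summits.CriticalPhenomena.PercolationContinuityZ3.Theorems.PercNearOneGluingNoHeavyLowerTailMajorityGluingZFourteenEightHG6C5
import Summits.CriticalPhenomena.PercolationContinuityZ3.Theorems.PercNearOneGluingNoHeavyLowerTailMajorityGluingZFourteenEightHG6C6
import Summits.CriticalPhenomena.PercolationContinuityZ3.Theorems.PercNearOneGluingNoHeavyLowerTailMajorityGluingZRangeAM
import HarnessLib

/-!
# Group 6 of 7 of the `(14,8)` certificate at `c = 3/2`: its aggregate-merge tree IS the concatenation of its 6 key-range chunks (lane prim-rate, constants-miner 1, gen 39; cert/mkhier.py)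

Support file for the closed crux `NoHeavyLowerTail` (stmt-CriticalPhenomena-4575), majority-gluing line.  The 12 parts P61, P62, P63, P64, P65, P66, P67, P68, P69, P70, P71, P72 (kit j310356) carry verified
type-space digests `…D`; `fourteenEightT2G6T` is their binary tree of aggregated merges (`am`, …MajorityGluingZRangeAM, depth 4); the kernel verifies `fourteenEightT2G6T = [chunks].flatten`
(`fourteenEightT2G6_eq`), and `fourteenEightT2G6_val` identifies the value of the group's digests with the value of its chunks (`evalC_am`).  No sorries. [cite: VandenbergKahn2001, Thm 1.2 (p. 123)]
-/

namespace Summit.CriticalPhenomena.PercolationContinuityZ3.Theorems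

namespace HubOnly
namespace QCert

/-- The aggregate-merge tree of group 6. -/
def fourteenEightT2G6T : List (ℕ × ℤ) :=
  am (am (am (am (fourteenEightTP61D) (fourteenEightTP62D)) (am (fourteenEightTP63D) (fourteenEightTP64D))) (am (am (fourteenEightTP65D) (fourteenEightTP66D)) (am (fourteenEightTP67D) (fourteenEightTP68D)))) (am (am (fourteenEightTP69D) (fourteenEightTP70D)) (am (fourteenEightTP71D) (fourteenEightTP72D)))

set_option maxRecDepth 8192 in
set_option maxHeartbeats 0 in
/-- **The tree of group 6 equals the concatenation of its key-range chunks** (kernel evaluation). -/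
theorem fourteenEightT2G6_eq : fourteenEightT2G6T = [fourteenEightT2G6C1, fourteenEightT2G6C2, fourteenEightT2G6C3, fourteenEightT2G6C4, fourteenEightT2G6C5, fourteenEightT2G6C6].flatten := by
  decide +kernel

/-- The tree's value is the value of the group's digests. -/
theorem fourteenEightT2G6_treeVal (val : ℕ → ℝ) : evalC val fourteenEightT2G6T = evalC val [fourteenEightTP61D, fourteenEightTP62D, fourteenEightTP63D, fourteenEightTP64D, fourteenEightTP65D, fourteenEightTP66D, fourteenEightTP67D, fourteenEightTP68D, fourteenEightTP69D, fourteenEightTP70D, fourteenEightTP71D, fourteenEightTP72D].flatten := by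
  simp only [fourteenEightT2G6T, evalC_am, List.flatten_cons, List.flatten_nil, evalC_append, evalC_nil', add_assoc, add_zero]

/-- **The value of group 6's digests is the value of its chunks.** -/
theorem fourteenEightT2G6_val (val : ℕ → ℝ) : evalC val [fourteenEightTP61D, fourteenEightTP62D, fourteenEightTP63D, fourteenEightTP64D, fourteenEightTP65D, fourteenEightTP66D, fourteenEightTP67D, fourteenEightTP68D, fourteenEightTP69D, fourteenEightTP70D, fourteenEightTP71D, fourteenEightTP72D].flatten = evalC val [fourteenEightT2G6C1, fourteenEightT2G6C2, fourteenEightT2G6C3, fourteenEightT2G6C4, fourteenEightT2G6C5, fourteenEightT2G6C6].flatten := by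
  rw [← fourteenEightT2G6_treeVal val, fourteenEightT2G6_eq]

end QCert
end HubOnly

end Summit.CriticalPhenomena.PercolationContinuityZ3.Theorems
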